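import Summits.ResolutionOfSingularities.ResolutionOfSingularities.Theorems.HomologicalConductorNoZenoPointBlowupH0One
import HarnessLib

/-!
# Crux `NoZenoR` (stmt-ResolutionOfSingularities-19943), slot 5 `stub_L1wCoreF`, (B1) UP-5 — scheme side, part 3/3:
# `Γ(2F, 𝒪)` and the `h⁰`-numerics of the exceptional curve (first kind)

OURS (cell res-hironaka, crux chain W4.4, seat res-L0-w44-stub-1 g11; object UP-5a/b of the (B1) split core of
slot 5 `stub_L1wCoreF`, res-L0-w44-stub-2 L1W-PREP §3.3 / lead B1-CENSUS-g8). Nothing here is a statement of the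
manuscript under review (Hironaka 2017); AI-written, weaker than expert review. Def-free, fact-free.

In the setting of part 2/3 (`ρ : X' → X` a blowing up of `J`, supported in an affine open `W` with
`J(W) = (u, v)` a regular pair in both orders, `π : X → Spec S`):

* `length_sections_comap_sq` — **`ℓ_S Γ(V((J·𝒪_{X'})²), 𝒪) = 3 · ℓ_S (Γ(X, W)/(u, v))`**: the sections of the
  first infinitesimal neighbourhood `2F` are an extension of `Γ(F, 𝒪_F) = κ` by `Γ(F, 𝓘_F/𝓘_F²) = κ ⊕ κT`
  (`length_equaliser_two`);
* in Lipman's currency `h0` (`Literature…Lipman1969RationalContraction`): **`h0_comap_eq`**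
  `h0 (ρ ≫ π) (J·𝒪_{X'}) = h0 π J` (UP-5a: `h⁰(F) =` `h⁰` of the centre `= [κ(x) : κ_S]`),
  **`h0_comap_sq_eq`** `h0 (ρ ≫ π) ((J·𝒪_{X'})²) = 3 · h0 π J` (UP-5b), and **`h0_comap_sq_eq_three_mul`**
  `h0 (𝓘_F²) = 3 · h0 𝓘_F` — with Prop. (13.1) d) (`(F·F) = 2h⁰(𝓘_F) − h⁰(𝓘_F²)`) this is `(F·F) = −h⁰(F)`:
  THE EXCEPTIONAL CURVE OF A POINT BLOW-UP IS OF THE FIRST KIND, the hypothesis shape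
  `h0 π (𝓘 ^ 2) = 3 * h0 π 𝓘` of `Lipman1969_27_1_reg_rat` for the node curves of the (B1) split core.

References: J. Lipman, Publ. Math. IHÉS 36 (1969), §13 Prop. (13.1) d), §15 p. 229, §23 Cor. (23.2), §27
Thm. (27.1) [`Lipman1969`]; R. Hartshorne, *Algebraic Geometry* (1977), V Prop. 3.1–3.2 [`Hartshorne1977`].
-/

noncomputable section

-- single-problem summit: the doubled namespace component `ResolutionOfSingularities` is forced
set_option linter.dupNamespace false

namespace Summit.ResolutionOfSingularities.ResolutionOfSingularities.Theorems.NoZeno.ExcCount.PointBlowup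

open CategoryTheory AlgebraicGeometry TopologicalSpace Opposite Polynomial
open Literature.AlgebraicGeometry.Resolution Literature.AlgebraicGeometry.Morphisms

universe u

/-! ## §7b The two charts of the blow-up of a regular pair: `h⁰` of `V((J·𝒪)²)` -/

section Main

variable {S : Type u} [CommRing S] {X X' : Scheme.{u}} [IsIntegral X']
  (π : X ⟶ Spec (.of S)) (ρ : X' ⟶ X) {J : X.IdealSheafData} (hρ : IsBlowup ρ J)
  (W : X.affineOpens) (hJW : (J.support : Set X) ⊆ (W : X.Opens))
  {u v : Γ(X, W)} (hI : J.ideal W = Ideal.span {u, v})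
  (hu : u ∈ nonZeroDivisors Γ(X, W)) (huv : ∀ r, u ∣ r * v → u ∣ r)
  (hv : v ∈ nonZeroDivisors Γ(X, W)) (hvu : ∀ r, v ∣ r * u → v ∣ r)
  (hne : Ideal.span {u, v} ≠ ⊤)

include hρ hJW hI hu huv hv hvu hne in
/-- **`ℓ_S Γ(V((J·𝒪_{X'})²), 𝒪) = 3 · ℓ_S (Γ(X, W)/J(W))`** for the blowing up `ρ : X' → X` of an ideal
sheaf `J` supported in an affine open `W` on which `J(W) = (u, v)` is generated by a regular pair (in
both orders) — the two-chart computation of `Γ(2F, 𝒪_{2F})` for the first infinitesimal neighbourhood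
`2F` of the exceptional curve `F = V(J·𝒪_{X'})`. Here `Γ(X, W)` is an `S`-algebra through
`π : X → Spec S`. [this work] -/
theorem length_sections_comap_sq :
    letI : Algebra S Γ(X, W) :=
      ((X.presheaf.map (homOfLE (le_top : (W : X.Opens) ≤ ⊤)).op).hom.comp (algebraMapΓ π)).toAlgebra
    Module.length S (Sections (((J.comap ρ) ^ 2).subschemeι ≫ ρ ≫ π) ⊤) =
      3 * Module.length S (Γ(X, W) ⧸ Ideal.span {u, v}) := by
  letI instSA : Algebra S Γ(X, W) :=
    ((X.presheaf.map (homOfLE (le_top : (W : X.Opens) ≤ ⊤)).op).hom.comp (algebraMapΓ π)).toAlgebra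
  have huI : u ∈ J.ideal W := hI ▸ Ideal.subset_span (by simp)
  have hvI : v ∈ J.ideal W := hI ▸ Ideal.subset_span (by simp)
  have hI' : J.ideal W = Ideal.span {v, u} := by rw [hI, Set.pair_comm]
  -- the two charts
  set U₁ : X'.Opens := blowupChart ρ J W u with hU₁
  set U₂ : X'.Opens := blowupChart ρ J W v with hU₂
  have hU₁a : IsAffineOpen U₁ := hρ.isAffineOpen_blowupChart huI
  have hU₂a : IsAffineOpen U₂ := hρ.isAffineOpen_blowupChart hvI
  have h₁ : U₁ ≤ ρ ⁻¹ᵁ (W : X.Opens) := blowupChart_le_preimage ρ J W u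
  have h₂ : U₂ ≤ ρ ⁻¹ᵁ (W : X.Opens) := blowupChart_le_preimage ρ J W v
  obtain ⟨e₁, he₁⟩ := hρ.exists_ringEquiv_blowupChart_pair W hI hu huv
  obtain ⟨e₂, he₂⟩ := hρ.exists_ringEquiv_blowupChart_pair W hI' hv hvu
  set T : Γ(X', U₁) := e₁.symm (Ideal.Quotient.mk _ Polynomial.X) with hTdef
  set T' : Γ(X', U₂) := e₂.symm (Ideal.Quotient.mk _ Polynomial.X) with hT'def
  have hT : ρ.appLE W U₁ h₁ v = ρ.appLE W U₁ h₁ u * T :=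
    appLE_eq_mul_of_ringEquiv_blowupChart_pair W h₁ e₁ he₁
  have hT' : ρ.appLE W U₂ h₂ u = ρ.appLE W U₂ h₂ v * T' :=
    appLE_eq_mul_of_ringEquiv_blowupChart_pair W h₂ e₂ he₂
  -- the overlap `U₁ ∩ U₂ = D(T)`
  have hO : X'.basicOpen T = U₁ ⊓ U₂ := hρ.basicOpen_chartRatio W huI hvI hT
  have hOa : IsAffineOpen (U₁ ⊓ U₂) := hO ▸ hU₁a.basicOpen T
  have h₁₂ : U₁ ⊓ U₂ ≤ ρ ⁻¹ᵁ (W : X.Opens) := inf_le_left.trans h₁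
  -- the cover and the support
  have hcov : U₁ ⊔ U₂ = ρ ⁻¹ᵁ (W : X.Opens) := hρ.blowupChart_sup_blowupChart_pair W hI
  have hsupp : (((J.comap ρ) ^ 2).support : Set X') ⊆ ((⟨U₁, hU₁a⟩ : X'.affineOpens) ⊔
      (⟨U₂, hU₂a⟩ : X'.affineOpens) : X'.Opens) := by
    intro y hy
    rw [Scheme.IdealSheafData.support_pow (n := 2) (hn := two_ne_zero),
      Scheme.IdealSheafData.support_comap] at hy
    change y ∈ U₁ ⊔ U₂
    rw [hcov]
    exact hJW hy
  have hne : Ideal.span {u, v} ≠ ⊤ := hne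
  -- sections of `V((J𝒪)²)` ↪ `Γ₁/I₁ × Γ₂/I₂`
  obtain ⟨Ψ, hΨinj, hΨrange, hΨc⟩ := exists_sections_subscheme_embedding ((J.comap ρ) ^ 2)
    ⟨U₁, hU₁a⟩ ⟨U₂, hU₂a⟩ hOa hsupp
  -- the chart ideals
  have hid : ∀ (U : X'.affineOpens) (hU : (U : X'.Opens) ≤ ρ ⁻¹ᵁ (W : X.Opens)),
      ((J.comap ρ) ^ 2).ideal U = ((Ideal.span {u, v}).map (ρ.appLE W U hU).hom) ^ 2 := by
    intro U hU
    rw [← comap_pow ρ J 2, ideal_comap_of_le ρ (J ^ 2) W U hU, Scheme.IdealSheafData.ideal_pow,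
      Pi.pow_apply, hI, Ideal.map_pow]
  -- `Γ(X, W)`-algebra structures on the chart rings
  letI alg₁ : Algebra Γ(X, W) Γ(X', U₁) := (ρ.appLE W U₁ h₁).hom.toAlgebra
  letI alg₂ : Algebra Γ(X, W) Γ(X', U₂) := (ρ.appLE W U₂ h₂).hom.toAlgebra
  letI alg₁₂ : Algebra Γ(X, W) Γ(X', U₁ ⊓ U₂) := (ρ.appLE W (U₁ ⊓ U₂) h₁₂).hom.toAlgebra
  letI sΓ₁ : Algebra S Γ(X', U₁) :=
    ((algebraMap Γ(X, W) Γ(X', U₁)).comp (algebraMap S Γ(X, W))).toAlgebra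
  letI sΓ₂ : Algebra S Γ(X', U₂) :=
    ((algebraMap Γ(X, W) Γ(X', U₂)).comp (algebraMap S Γ(X, W))).toAlgebra
  haveI : IsScalarTower S Γ(X, W) Γ(X', U₁) := IsScalarTower.of_algebraMap_eq (fun _ => rfl)
  haveI : IsScalarTower S Γ(X, W) Γ(X', U₂) := IsScalarTower.of_algebraMap_eq (fun _ => rfl)
  have halg₁ : ∀ a, algebraMap Γ(X, W) Γ(X', U₁) a = ρ.appLE W U₁ h₁ a := fun _ => rfl
  have halg₂ : ∀ a, algebraMap Γ(X, W) Γ(X', U₂) a = ρ.appLE W U₂ h₂ a := fun _ => rfl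
  have halg₁₂ : ∀ a, algebraMap Γ(X, W) Γ(X', U₁ ⊓ U₂) a = ρ.appLE W (U₁ ⊓ U₂) h₁₂ a :=
    fun _ => rfl
  -- the restriction maps to the overlap
  let r₁ : Γ(X', U₁) →ₐ[Γ(X, W)] Γ(X', U₁ ⊓ U₂) :=
    { (X'.presheaf.map (homOfLE (inf_le_left : U₁ ⊓ U₂ ≤ U₁)).op).hom with
      commutes' := fun a => map_appLE_eq h₁ inf_le_left a }
  let r₂ : Γ(X', U₂) →ₐ[Γ(X, W)] Γ(X', U₁ ⊓ U₂) :=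
    { (X'.presheaf.map (homOfLE (inf_le_right : U₁ ⊓ U₂ ≤ U₂)).op).hom with
      commutes' := fun a => map_appLE_eq h₂ inf_le_right a }
  have hr₁a : ∀ a, r₁ a = X'.presheaf.map (homOfLE (inf_le_left : U₁ ⊓ U₂ ≤ U₁)).op a :=
    fun _ => rfl
  have hr₂a : ∀ b, r₂ b = X'.presheaf.map (homOfLE (inf_le_right : U₁ ⊓ U₂ ≤ U₂)).op b :=
    fun _ => rfl
  -- the quotient isomorphisms `εᵢ`
  have he₁' : ∀ a, e₁ (algebraMap Γ(X, W) Γ(X', U₁) a) = Ideal.Quotient.mk _ (C a) := he₁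
  have he₂' : ∀ a, e₂ (algebraMap Γ(X, W) Γ(X', U₂) a) = Ideal.Quotient.mk _ (C a) := he₂
  obtain ⟨ε₁, hε₁C, hε₁X⟩ := exists_ringEquiv_quotient_of_ringEquiv_pair_algebra
    (algebraMap Γ(X, W) Γ(X', U₁)) u v e₁ he₁' (Ideal.span {u, v}) le_rfl
  obtain ⟨ε₂, hε₂C, hε₂X⟩ := exists_ringEquiv_quotient_of_ringEquiv_pair_algebra
    (algebraMap Γ(X, W) Γ(X', U₂)) v u e₂ he₂' (Ideal.span {u, v}) (by rw [Set.pair_comm])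
  have hvu₁ : algebraMap Γ(X, W) Γ(X', U₁) v = algebraMap Γ(X, W) Γ(X', U₁) u * T := hT
  have huv₂ : algebraMap Γ(X, W) Γ(X', U₂) u = algebraMap Γ(X, W) Γ(X', U₂) v * T' := hT'
  have hgen₁ := exists_eq_aeval_of_chartEquiv u v T e₁ he₁' hTdef
  have hgen₂ := exists_eq_aeval_of_chartEquiv v u T' e₂ he₂' hT'def
  -- `T ≠ 0`, so the overlap is non-empty and its ring is a domain
  haveI : Nontrivial (Γ(X, W) ⧸ Ideal.span {u, v}) := Ideal.Quotient.nontrivial_iff.mpr hne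
  have hT0 : T ≠ 0 := by
    intro h0
    have := hε₁X
    rw [← hTdef, h0, map_zero, map_zero] at this
    exact Polynomial.X_ne_zero this.symm
  have hOne : (U₁ ⊓ U₂ : X'.Opens) ≠ ⊥ := by
    rw [← hO, ne_eq, basicOpen_eq_bot_iff]; exact hT0
  obtain ⟨y₀, hy₀⟩ : ∃ y, y ∈ (U₁ ⊓ U₂ : X'.Opens) := by
    by_contra hc
    exact hOne (le_bot_iff.mp fun y hy => (hc ⟨y, hy⟩).elim)
  haveI : Nonempty (U₁ ⊓ U₂ : X'.Opens) := ⟨⟨y₀, hy₀⟩⟩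
  haveI : Nonempty (U₁ : X'.Opens) := ⟨⟨y₀, (Opens.mem_inf.mp hy₀).1⟩⟩
  haveI : Nontrivial Γ(X', U₁) := Scheme.component_nontrivial X' U₁
  have hr₁ : Function.Injective r₁ := map_injective_of_isIntegral X' (homOfLE inf_le_left)
  have hr₂ : Function.Injective r₂ := map_injective_of_isIntegral X' (homOfLE inf_le_right)
  -- `T · T' = 1` on the overlap
  have hTT' : r₁ T * r₂ T' = 1 := by
    have h := hρ.chartRatio_mul_chartRatio W huI hvI hT hT' (Tuw := 1) (by rw [mul_one])
    rw [map_one] at h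
    exact h
  -- the overlap is the localisation of `U₁` at `T`
  have hloc : ∀ z : Γ(X', U₁ ⊓ U₂), ∃ (c : Γ(X', U₁)) (e : ℕ), r₁ T ^ e * z = r₁ c := by
    letI := (X'.presheaf.map (homOfLE (inf_le_left : U₁ ⊓ U₂ ≤ U₁)).op).hom.toAlgebra
    haveI : IsLocalization.Away T Γ(X', U₁ ⊓ U₂) :=
      hU₁a.isLocalization_of_eq_basicOpen T (homOfLE inf_le_left) hO.symm
    intro z
    obtain ⟨⟨c, ⟨_, e, rfl⟩⟩, hce⟩ := IsLocalization.surj (Submonoid.powers T) z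
    refine ⟨c, e, ?_⟩
    have hce' : z * r₁ (T ^ e) = r₁ c := hce
    rw [map_pow, mul_comm] at hce'
    exact hce'
  -- `u ≠ 0` on the overlap
  have hu₀ : algebraMap Γ(X, W) Γ(X', U₁ ⊓ U₂) u ≠ 0 := by
    obtain ⟨h₁', hnzd, -⟩ := hρ.isPrincipalChart_blowupChart huI
    have hnzd' : algebraMap Γ(X, W) Γ(X', U₁) u ∈ nonZeroDivisors Γ(X', U₁) := hnzd
    intro h0
    have : r₁ (algebraMap Γ(X, W) Γ(X', U₁) u) = 0 := by rw [r₁.commutes]; exact h0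
    rw [map_eq_zero_iff _ hr₁] at this
    exact nonZeroDivisors.ne_zero hnzd' this
  -- `V((J𝒪)²) → X'` lands in `ρ⁻¹W`
  have hO' : (⊤ : ((J.comap ρ) ^ 2).subscheme.Opens) ≤
      ((J.comap ρ) ^ 2).subschemeι ⁻¹ᵁ (ρ ⁻¹ᵁ (W : X.Opens)) := by
    intro p _
    have hp : ((J.comap ρ) ^ 2).subschemeι.base p ∈ (((J.comap ρ) ^ 2).support : Set X') := by
      rw [← Scheme.IdealSheafData.range_subschemeι]; exact ⟨p, rfl⟩
    have := hsupp hp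
    change ((J.comap ρ) ^ 2).subschemeι.base p ∈ U₁ ⊔ U₂ at this
    rw [hcov] at this
    exact this
  have hψA : ∀ a : Γ(X, W),
      Ψ (((J.comap ρ) ^ 2).subschemeι.appLE (ρ ⁻¹ᵁ (W : X.Opens)) ⊤ hO' (ρ.app W a)) =
        (Ideal.Quotient.mk _ (algebraMap Γ(X, W) Γ(X', U₁) a),
          Ideal.Quotient.mk _ (algebraMap Γ(X, W) Γ(X', U₂) a)) :=
    fun a => hΨc (ρ ⁻¹ᵁ (W : X.Opens)) hO' h₁ h₂ (ρ.app W a)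
  -- the equaliser `E = range Ψ` as a `Γ(X, W)`-submodule
  let E : Submodule Γ(X, W) ((Γ(X', U₁) ⧸ ((J.comap ρ) ^ 2).ideal ⟨U₁, hU₁a⟩) ×
      (Γ(X', U₂) ⧸ ((J.comap ρ) ^ 2).ideal ⟨U₂, hU₂a⟩)) :=
    { carrier := Set.range Ψ
      add_mem' := by
        rintro _ _ ⟨s₁, rfl⟩ ⟨s₂, rfl⟩
        exact ⟨s₁ + s₂, map_add Ψ s₁ s₂⟩
      zero_mem' := ⟨0, map_zero Ψ⟩
      smul_mem' := by
        rintro a _ ⟨s₁, rfl⟩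
        refine ⟨((J.comap ρ) ^ 2).subschemeι.appLE (ρ ⁻¹ᵁ (W : X.Opens)) ⊤ hO' (ρ.app W a) * s₁, ?_⟩
        rw [map_mul, hψA, Algebra.smul_def, Prod.algebraMap_apply, algebraMap_quotient_apply,
          algebraMap_quotient_apply] }
  have hE : ∀ m, m ∈ E ↔ m ∈ Set.range Ψ := fun _ => Iff.rfl
  have hE' : ∀ (a : Γ(X', U₁)) (b : Γ(X', U₂)),
      (Ideal.Quotient.mk _ a, Ideal.Quotient.mk _ b) ∈ E ↔
        r₁ a - r₂ b ∈ ((J.comap ρ) ^ 2).ideal ⟨U₁ ⊓ U₂, hOa⟩ := fun a b => hΨrange a b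
  -- the chart ideals are `(u₁²)`, `(v₂²)`, `(û²)`
  have hI₁ : ((J.comap ρ) ^ 2).ideal ⟨U₁, hU₁a⟩ =
      Ideal.span {algebraMap Γ(X, W) Γ(X', U₁) u ^ 2} := by
    rw [hid ⟨U₁, hU₁a⟩ h₁]; exact map_span_pair_pow_eq u v T hvu₁ 2
  have hI₂ : ((J.comap ρ) ^ 2).ideal ⟨U₂, hU₂a⟩ =
      Ideal.span {algebraMap Γ(X, W) Γ(X', U₂) v ^ 2} := by
    rw [hid ⟨U₂, hU₂a⟩ h₂, Set.pair_comm]; exact map_span_pair_pow_eq v u T' huv₂ 2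
  have hI₁₂ : ((J.comap ρ) ^ 2).ideal ⟨U₁ ⊓ U₂, hOa⟩ =
      Ideal.span {algebraMap Γ(X, W) Γ(X', U₁ ⊓ U₂) u ^ 2} := by
    rw [hid ⟨U₁ ⊓ U₂, hOa⟩ h₁₂]
    have hv₁₂ : algebraMap Γ(X, W) Γ(X', U₁ ⊓ U₂) v =
        algebraMap Γ(X, W) Γ(X', U₁ ⊓ U₂) u * r₁ T := by
      rw [← r₁.commutes v, hvu₁, map_mul, r₁.commutes]
    exact map_span_pair_pow_eq u v (r₁ T) hv₁₂ 2
  -- `Ψ` is compatible with the structure maps from `S`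
  have hS : ∀ s, Ψ (algebraMap S (Sections (((J.comap ρ) ^ 2).subschemeι ≫ ρ ≫ π) ⊤) s) =
      algebraMap S _ s := by
    intro s
    rw [algebraMap_sections_eq π ρ _ (W : X.Opens) hO', hψA]
    rfl
  -- lengths
  have hlen := length_equaliser_two (S := S) r₁ r₂ u v T T' ε₁ hε₁C hε₁X ε₂ hε₂C hε₂X hvu₁ huv₂
    hu₀ hr₁ hr₂ hloc hgen₁ hgen₂ hTT' _ hI₁ _ hI₂ _ hI₁₂ E hE'
  rw [← hlen]
  exact length_eq_of_injective_of_range_eq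
    (R := Sections (((J.comap ρ) ^ 2).subschemeι ≫ ρ ≫ π) ⊤) Ψ hΨinj hS E hE



end Main

/-! ## §8 The `h⁰`-numerics in Lipman's currency -/

section H0

variable {S : Type u} [CommRing S] {X X' : Scheme.{u}} [IsIntegral X']
  (π : X ⟶ Spec (.of S)) (ρ : X' ⟶ X) {J : X.IdealSheafData} (hρ : IsBlowup ρ J)
  (W : X.affineOpens) (hJW : (J.support : Set X) ⊆ (W : X.Opens))
  {u v : Γ(X, W)} (hI : J.ideal W = Ideal.span {u, v})
  (hu : u ∈ nonZeroDivisors Γ(X, W)) (huv : ∀ r, u ∣ r * v → u ∣ r)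
  (hv : v ∈ nonZeroDivisors Γ(X, W)) (hvu : ∀ r, v ∣ r * u → v ∣ r)
  (hne : Ideal.span {u, v} ≠ ⊤)

include hρ hJW hI hu huv hv hvu hne in
/-- **UP-5a: `h⁰(𝒪_{X'}/J𝒪_{X'}) = h⁰(𝒪_X/J)`** — the exceptional curve `F = V(J·𝒪_{X'})` of the blowing up
of a regular pair has `h⁰(F) = h⁰` of its centre (`= [κ(x) : κ]` for the reduced point `x`).
[this work] -/
theorem h0_comap_eq : h0 (ρ ≫ π) (J.comap ρ) = h0 π J := by
  rw [h0_eq, length_sections_comap π ρ hρ W hJW hI hu huv hv hvu hne,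
    h0_eq_length_quotient π J W hJW, hI]

include hρ hJW hI hu huv hv hvu hne in
/-- **UP-5b: `h⁰(𝒪_{X'}/(J𝒪_{X'})²) = 3 · h⁰(𝒪_X/J)`** — the first infinitesimal neighbourhood `2F` of
the exceptional curve has `h⁰(𝒪_{2F}) = 3 h⁰` of the centre. [this work] -/
theorem h0_comap_sq_eq : h0 (ρ ≫ π) (J.comap ρ ^ 2) = 3 * h0 π J := by
  rw [h0_eq, length_sections_comap_sq π ρ hρ W hJW hI hu huv hv hvu hne,
    h0_eq_length_quotient π J W hJW, hI]

include hρ hJW hI hu huv hv hvu hne in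
/-- **UP-5 (first kind): `h⁰(𝓘_F²) = 3 · h⁰(𝓘_F)`** for `𝓘_F = J·𝒪_{X'}` — in Lipman's dictionary
(`(F·F) = 2 h⁰(𝓘_F) − h⁰(𝓘_F²)`, Prop. (13.1) d)) this is `(F·F) = −h⁰(F)`, i.e. the exceptional curve
of a point blow-up is OF THE FIRST KIND — the hypothesis shape of `Lipman1969_27_1_reg_rat`.
[this work] -/
theorem h0_comap_sq_eq_three_mul : h0 (ρ ≫ π) (J.comap ρ ^ 2) = 3 * h0 (ρ ≫ π) (J.comap ρ) := by
  rw [h0_comap_sq_eq π ρ hρ W hJW hI hu huv hv hvu hne, h0_comap_eq π ρ hρ W hJW hI hu huv hv hvu hne]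

end H0

end Summit.ResolutionOfSingularities.ResolutionOfSingularities.Theorems.NoZeno.ExcCount.PointBlowup

end
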